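import Literature.Topology.FourManifolds.GluckTwist
import HarnessLib

/-!
# Named facts about Gluck twists (Gluck 1962; Freedman 1982) — sorry-free hypotheses

D-0014 named facts requested by route SmoothPoincare4/GluckLasagna (`wi-03951`). The interim file
`GluckTwist.lean` still carries these results as SORRIED theorems
(`Literature.Topology.FourManifolds.nonempty_homeomorph_sphere_of_isGluckTwist`, `Literature.Topology.FourManifolds.simplyConnectedSpace_of_isGluckTwist`,
`Literature.Topology.FourManifolds.IsGluckTwist.compactSpace`, `Literature.Topology.FourManifolds.exists_isGluckTwist`, tagged `[cite pending]`); until that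
file is migrated, routes cannot use them under D-0014. This file records the same statements as
`Prop`-valued named facts over the honest definition `Literature.Topology.FourManifolds.IsGluckTwist` (a real `def`: an open
gluing of `S⁴ ∖ K(S²)` and `S² × ℝ²` along the Gluck map on a tubular neighbourhood), for the
universe-`0` carrier `X : Type` the route consumes. Nothing here depends on a sorried declaration.

* `gluck_homeomorph_sphere_four` — a Gluck twist `Σ_K` of `S⁴` along any 2-knot `K` is
  homeomorphic to `S⁴`: `Σ_K` is a simply connected closed smooth 4-manifold with the integral
  homology of `S⁴` (Gluck, Trans. AMS 104 (1962), §17: Seifert–van Kampen and Mayer–Vietoris),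
  hence a homotopy 4-sphere, hence homeomorphic to `S⁴` by Freedman (J. Differential Geom. 17
  (1982), Thm. 1.6). Whether `Σ_K ≅ S⁴` smoothly is open (Kirby Problem 4.24).
* `gluck_simplyConnected` (Gluck 1962, §17), `gluck_compactSpace` (Gluck 1962, §17: `Σ_K` is
  closed), `gluck_exists` (Gluck 1962, §§8, 17: the twist exists as a closed smooth 4-manifold).

## References

* H. Gluck, *The embedding of two-spheres in the four-sphere*, Trans. Amer. Math. Soc. 104 (1962)
  308–333, §§8, 17 [Gluck1962].
* M. H. Freedman, *The topology of four-dimensional manifolds*, J. Differential Geom. 17 (1982)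
  357–453, Thm. 1.6 [FreedmanJDG1982].
* R. Gompf, A. Stipsicz, *4-Manifolds and Kirby Calculus* (1999), §6.2, Ex. 6.2.2.
-/

noncomputable section

open scoped Manifold ContDiff

namespace Literature.Topology.FourManifolds

/-- Local notation for the round `n`-sphere in `ℝⁿ⁺¹`. -/
local notation "𝕊 " n:arg => (Metric.sphere (0 : EuclideanSpace ℝ (Fin (n + 1))) 1)

/-- **Gluck 1962 §17 + Freedman 1982 Thm. 1.6: a Gluck twist of `S⁴` is homeomorphic to `S⁴`.**
For every 2-knot `K` and every Hausdorff second-countable smooth 4-manifold `X` (atlas on `ℝ⁴`)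
which is a Gluck twist of `S⁴` along `K` (`IsGluckTwist (𝓡 4) X K`), `X` is homeomorphic to `S⁴`.
[cite: Gluck1962, §17] [cite: FreedmanJDG1982, Thm. 1.6] -/
def gluck_homeomorph_sphere_four : Prop :=
  ∀ (K : TwoKnot) (X : Type) [TopologicalSpace X] [T2Space X] [SecondCountableTopology X]
    [ChartedSpace (EuclideanSpace ℝ (Fin 4)) X] [IsManifold (𝓡 4) ∞ X],
    IsGluckTwist (𝓡 4) X K → Nonempty (X ≃ₜ (𝕊 4))

/-- **Gluck 1962, §17: a Gluck twist is simply connected** (`π₁(S⁴ ∖ K)` is normally generated by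
a meridian, which still bounds a disc after regluing since `τ` preserves meridians).
[cite: Gluck1962, §17] -/
def gluck_simplyConnected : Prop :=
  ∀ (K : TwoKnot) (X : Type) [TopologicalSpace X] [T2Space X] [SecondCountableTopology X]
    [ChartedSpace (EuclideanSpace ℝ (Fin 4)) X] [IsManifold (𝓡 4) ∞ X],
    IsGluckTwist (𝓡 4) X K → SimplyConnectedSpace X

/-- **Gluck 1962, §17: a Gluck twist is compact** (union of the images of the compact pieces
`S⁴ ∖ ν(S² × B₁)` and `S² × B̄₁`). [cite: Gluck1962, §17] -/
def gluck_compactSpace : Prop :=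
  ∀ (K : TwoKnot) (X : Type) [TopologicalSpace X] [T2Space X] [SecondCountableTopology X]
    [ChartedSpace (EuclideanSpace ℝ (Fin 4)) X] [IsManifold (𝓡 4) ∞ X],
    IsGluckTwist (𝓡 4) X K → CompactSpace X

/-- **Gluck 1962, §§8, 17: existence of the Gluck twist** as a closed (compact, Hausdorff, second
countable) smooth 4-manifold, for every 2-knot. [cite: Gluck1962, §8 and §17] -/
def gluck_exists : Prop :=
  ∀ K : TwoKnot, ∃ (X : Type) (_ : TopologicalSpace X) (_ : T2Space X)
    (_ : SecondCountableTopology X) (_ : ChartedSpace (EuclideanSpace ℝ (Fin 4)) X)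
    (_ : IsManifold (𝓡 4) ∞ X) (_ : CompactSpace X), IsGluckTwist (𝓡 4) X K

/-- Packaging for the route: under the two facts, every Gluck twist is a compact space homeomorphic
to `S⁴`. [folklore] -/
theorem gluck_homeomorph_sphere_four.compact_and_homeomorph (h : gluck_homeomorph_sphere_four)
    (hc : gluck_compactSpace) (K : TwoKnot) (X : Type) [TopologicalSpace X] [T2Space X]
    [SecondCountableTopology X] [ChartedSpace (EuclideanSpace ℝ (Fin 4)) X] [IsManifold (𝓡 4) ∞ X]
    (hX : IsGluckTwist (𝓡 4) X K) : CompactSpace X ∧ Nonempty (X ≃ₜ (𝕊 4)) :=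
  ⟨hc K X hX, h K X hX⟩

end Literature.Topology.FourManifolds

end
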